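import Summits.QuantumFields.QCD.Theses.PauliWegnerSea
import Literature.MathematicalPhysics.QuantumFieldTheory.StrongCouplingActivities
import Literature.MathematicalPhysics.QuantumFieldTheory.QCDPhaseQuenched

/-!
# Crux `TiltedFlatness` (stmt-QuantumFields-14070), line `circle-transport` — stub `stub_eulerWord`

**What is proved.** `stub_eulerWord`: for every one-parameter family `T : ℝ → SU(3)` with
`T(θ) = diag(e^{iθ}, e^{-iθ}, 1)` there are `d = 9` FIXED conjugators `V₀, …, V₈ ∈ SU(3)` such that
every `g ∈ SU(3)` is the ordered word `∏ⱼ Vⱼ · T(sⱼ) · Vⱼ⁻¹` for suitable angles `s` (depending on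
`g`): surjectivity of a fixed word of conjugated circles (generalized Euler angles for `SU(3)`).

**Proof (all conjugators explicit, everything at the matrix level).**
* `W := [[(1+i)/2, -(1+i)/2, 0], [(1-i)/2, (1-i)/2, 0], [0, 0, 1]] ∈ SU(3)` tilts the torus into the
  real rotations of the `01`-plane: `W · T(b) · W† = Y(b) := [[cos b, -sin b, 0], [sin b, cos b, 0],
  [0, 0, 1]]` (`tilt_conj_diagonal`), so `T(a) · (W T(b) W⁻¹) · T(c)` is the explicit `ZYZ` matrix
  (`coe_zyz`).
* LEMMA A (`exists_zyz`): an element `k ∈ SU(3)` with `k₂₂ = 1` is a block `SU(2)` matrix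
  `[[α, -conj β, 0], [β, conj α, 0], [0, 0, 1]]`, `|α|² + |β|² = 1` (`entries_of_two_two`: the third
  row and column of a unitary matrix are unit vectors, then `k⁻¹ = k† ` and `det k = 1`), and it equals
  `T(a) (W T(b) W⁻¹) T(c)` for `b = arccos |α|`, `a = (arg α - arg β)/2`, `c = (arg α + arg β)/2`
  (polar forms `|z| e^{i arg z} = z`).
* LEMMA B (`block_reduction`): for every `g` there are block matrices `k₁, k₂` (fixing `e₂`) with
  `(k₁⁻¹ g k₂)₀₀ = 1`: choose a unit vector `w = (w₁, w₂, 0)` killed by the third row of `g`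
  (`exists_unit_orth`), let `k₂` be the block matrix with first column `w`, and `k₁` the block matrix
  whose first column is the (unit) first column of `g k₂`.
* The cyclic permutation matrix `P` (`e₀ ↦ e₁ ↦ e₂ ↦ e₀`) satisfies `(P⁻¹ m P)₂₂ = m₀₀`
  (`perm_conj_apply_two_two`), so Lemma A applies to `P⁻¹ (k₁⁻¹ g k₂) P`, and
  `g = k₁ · P (ZYZ) P⁻¹ · k₂⁻¹` is the word with conjugators `V = (1, W, 1, P, PW, P, 1, W, 1)`
  (a `group` computation after unfolding `List.ofFn`).

**Sources.** Generalized Euler angles for `SU(3)`: D. J. Rowe, B. C. Sanders, H. de Guise,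
*Representations of the Weyl group and Wigner functions for SU(3)*, J. Math. Phys. 40 (1999) 3604;
M. Byrd, *Differential geometry on SU(3) with applications to three state systems*, J. Math. Phys. 39
(1998) 6125 (physics/9708015).  The `SU(2)` step is the `Z–Y` decomposition of Nielsen–Chuang,
Thm. 4.1.  All statements here are folklore linear algebra; no named fact of the tree is used.
-/

noncomputable section

namespace Summit.QuantumFields.QCD.Theorems.CircleTransport

open scoped BigOperators Real Matrix.Norms.L2Operator
open MeasureTheory Set Filter
open Literature.MathematicalPhysics.QuantumFieldTheory Literature.MathematicalPhysics.QuantumLattice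
  Literature.Probability.LatticeModels

/-- `SU(3)` (the tree's `Matrix.specialUnitaryGroup (Fin 3) ℂ`). -/
local notation "SU3" => Matrix.specialUnitaryGroup (Fin 3) ℂ

namespace EulerWord

open Complex

/-! ### Explicit `3 × 3` matrices -/

/-- The conjugate transpose of an explicit `3 × 3` complex matrix. -/
theorem star_fin_three (a b c d e f g h i : ℂ) :
    star !![a, b, c; d, e, f; g, h, i] =
      !![(starRingEnd ℂ) a, (starRingEnd ℂ) d, (starRingEnd ℂ) g;
         (starRingEnd ℂ) b, (starRingEnd ℂ) e, (starRingEnd ℂ) h;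
         (starRingEnd ℂ) c, (starRingEnd ℂ) f, (starRingEnd ℂ) i] := by
  ext i j
  fin_cases i <;> fin_cases j <;> rfl

/-- The tilting matrix `W = [[(1+i)/2, -(1+i)/2, 0], [(1-i)/2, (1-i)/2, 0], [0, 0, 1]]` lies in
`SU(3)`. -/
theorem tiltMatrix_mem :
    !![(1 + I) / 2, -((1 + I) / 2), 0; (1 - I) / 2, (1 - I) / 2, 0; 0, 0, 1] ∈
      Matrix.specialUnitaryGroup (Fin 3) ℂ := by
  rw [Matrix.mem_specialUnitaryGroup_iff, Matrix.mem_unitaryGroup_iff, star_fin_three,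
    Matrix.mul_fin_three, Matrix.one_fin_three, Matrix.det_fin_three]
  simp only [map_neg, map_zero, map_one, map_div₀, map_add, map_sub, Complex.conj_I, Complex.conj_ofNat]
  constructor
  · ext i j
    fin_cases i <;> fin_cases j <;> simp [Complex.ext_iff, Complex.div_ofNat_re, Complex.div_ofNat_im] <;>
      norm_num
  · simp [Complex.ext_iff, Complex.div_ofNat_re, Complex.div_ofNat_im]
    norm_num

/-- The cyclic permutation matrix `P` (`e₀ ↦ e₁ ↦ e₂ ↦ e₀`) lies in `SU(3)`. -/
theorem permMatrix_mem :
    !![(0 : ℂ), 0, 1; 1, 0, 0; 0, 1, 0] ∈ Matrix.specialUnitaryGroup (Fin 3) ℂ := by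
  rw [Matrix.mem_specialUnitaryGroup_iff, Matrix.mem_unitaryGroup_iff, star_fin_three,
    Matrix.mul_fin_three, Matrix.one_fin_three, Matrix.det_fin_three]
  simp only [map_zero, map_one]
  constructor
  · ext i j
    fin_cases i <;> fin_cases j <;> simp
  · simp

/-- Block `SU(2)` matrices in rows/columns `0, 1` lie in `SU(3)`. -/
theorem blockMatrix_mem {α β : ℂ} (h : (starRingEnd ℂ) α * α + (starRingEnd ℂ) β * β = 1) :
    !![α, -(starRingEnd ℂ) β, 0; β, (starRingEnd ℂ) α, 0; 0, 0, 1] ∈ Matrix.specialUnitaryGroup (Fin 3) ℂ := by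
  rw [Matrix.mem_specialUnitaryGroup_iff, Matrix.mem_unitaryGroup_iff, star_fin_three,
    Matrix.mul_fin_three, Matrix.one_fin_three, Matrix.det_fin_three]
  simp only [map_neg, Complex.conj_conj, map_zero, map_one]
  constructor
  · ext i j
    fin_cases i <;> fin_cases j <;> simp <;> first | linear_combination h | ring1
  · simp
    linear_combination h

/-- `W · diag(e^{ib}, e^{-ib}, 1) · W† = Y(b)`, the real rotation by `b` in the `01`-plane. -/
theorem tilt_conj_diagonal (b : ℝ) :
    !![(1 + I) / 2, -((1 + I) / 2), 0; (1 - I) / 2, (1 - I) / 2, 0; 0, 0, 1] *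
        Matrix.diagonal ![cexp (b * I), cexp (-(b * I)), 1] *
        star !![(1 + I) / 2, -((1 + I) / 2), 0; (1 - I) / 2, (1 - I) / 2, 0; 0, 0, 1] =
      !![(Real.cos b : ℂ), -(Real.sin b : ℂ), 0; (Real.sin b : ℂ), (Real.cos b : ℂ), 0; 0, 0, 1] := by
  rw [star_fin_three, Matrix.diagonal_vec3, Matrix.mul_fin_three, Matrix.mul_fin_three]
  simp only [map_neg, map_zero, map_one, map_div₀, map_add, map_sub, Complex.conj_I, Complex.conj_ofNat]
  ext i j
  fin_cases i <;> fin_cases j <;>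
    simp [Complex.ext_iff, Complex.div_ofNat_re, Complex.div_ofNat_im, Complex.exp_re, Complex.exp_im,
      -Complex.ofReal_cos, -Complex.ofReal_sin] <;> constructor <;> ring

/-- The matrix of the `ZYZ` word `T(a) · (W T(b) W⁻¹) · T(c)`:
`[[e^{ia} cos b e^{ic}, -e^{ia} sin b e^{-ic}, 0], [e^{-ia} sin b e^{ic}, e^{-ia} cos b e^{-ic}, 0], [0, 0, 1]]`. -/
theorem coe_zyz (T : ℝ → SU3)
    (hT : ∀ θ : ℝ, ((T θ : SU3) : Matrix (Fin 3) (Fin 3) ℂ) =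
      Matrix.diagonal ![Complex.exp (θ * Complex.I), Complex.exp (-(θ * Complex.I)), 1])
    (W : SU3) (hW : (W : Matrix (Fin 3) (Fin 3) ℂ) =
      !![(1 + I) / 2, -((1 + I) / 2), 0; (1 - I) / 2, (1 - I) / 2, 0; 0, 0, 1]) (a b c : ℝ) :
    ((T a * (W * T b * W⁻¹) * T c : SU3) : Matrix (Fin 3) (Fin 3) ℂ) =
      !![cexp (a * I) * Real.cos b * cexp (c * I), -(cexp (a * I) * Real.sin b * cexp (-(c * I))), 0;
         cexp (-(a * I)) * Real.sin b * cexp (c * I), cexp (-(a * I)) * Real.cos b * cexp (-(c * I)), 0;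
         0, 0, 1] := by
  rw [Submonoid.coe_mul, Submonoid.coe_mul, Submonoid.coe_mul, Submonoid.coe_mul, ← Matrix.star_eq_inv,
    Matrix.specialUnitaryGroup.coe_star, hT, hT, hT, hW, tilt_conj_diagonal, Matrix.diagonal_vec3,
    Matrix.diagonal_vec3, Matrix.mul_fin_three, Matrix.mul_fin_three]
  ext i j
  fin_cases i <;> fin_cases j <;> simp [-Complex.ofReal_cos, -Complex.ofReal_sin]

/-- Conjugation by the cyclic permutation `P` moves the `00` entry to the `22` entry:
`(P† M P)₂₂ = M₀₀`. -/
theorem perm_conj_apply_two_two (M : Matrix (Fin 3) (Fin 3) ℂ) :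
    (star !![(0 : ℂ), 0, 1; 1, 0, 0; 0, 1, 0] * M * !![(0 : ℂ), 0, 1; 1, 0, 0; 0, 1, 0]) 2 2 = M 0 0 := by
  rw [star_fin_three, Matrix.eta_fin_three M, Matrix.mul_fin_three, Matrix.mul_fin_three]
  simp

/-! ### Lemma A: `ZYZ` Euler angles in the `01`-block -/

/-- Structure of an element `k ∈ SU(3)` with `k₂₂ = 1`: its third row and column vanish off the
diagonal (they are unit vectors), and the `01`-block is an `SU(2)` matrix `[[α, -conj β], [β, conj α]]`
with `|α|² + |β|² = 1` (orthonormality of the columns and `det k = 1`). -/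
theorem entries_of_two_two {k : Matrix (Fin 3) (Fin 3) ℂ} (hk : k ∈ Matrix.specialUnitaryGroup (Fin 3) ℂ)
    (h22 : k 2 2 = 1) :
    k 2 0 = 0 ∧ k 2 1 = 0 ∧ k 0 2 = 0 ∧ k 1 2 = 0 ∧
      k 0 1 = -(starRingEnd ℂ) (k 1 0) ∧ k 1 1 = (starRingEnd ℂ) (k 0 0) ∧
      (starRingEnd ℂ) (k 0 0) * k 0 0 + (starRingEnd ℂ) (k 1 0) * k 1 0 = 1 := by
  rw [Matrix.mem_specialUnitaryGroup_iff] at hk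
  have h1 : k * star k = 1 := Matrix.mem_unitaryGroup_iff.1 hk.1
  have h2 : star k * k = 1 := Matrix.mem_unitaryGroup_iff'.1 hk.1
  have hdet := hk.2
  rw [Matrix.star_eq_conjTranspose] at h1 h2
  have e22 := congr_fun (congr_fun h1 2) 2
  have f22 := congr_fun (congr_fun h2 2) 2
  have f00 := congr_fun (congr_fun h2 0) 0
  have f01 := congr_fun (congr_fun h2 0) 1
  simp only [Matrix.mul_apply, Fin.sum_univ_three, Matrix.conjTranspose_apply, Complex.star_def,
    Matrix.one_apply_eq, Matrix.one_apply_ne (by decide : (0 : Fin 3) ≠ 1), h22, map_one,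
    mul_one] at e22 f22 f00 f01
  rw [Complex.mul_conj, Complex.mul_conj] at e22
  rw [← Complex.normSq_eq_conj_mul_self, ← Complex.normSq_eq_conj_mul_self] at f22
  have e22' : Complex.normSq (k 2 0) + Complex.normSq (k 2 1) + 1 = 1 := by exact_mod_cast e22
  have f22' : Complex.normSq (k 0 2) + Complex.normSq (k 1 2) + 1 = 1 := by exact_mod_cast f22
  have h20 : k 2 0 = 0 := Complex.normSq_eq_zero.1
    (by linarith [Complex.normSq_nonneg (k 2 0), Complex.normSq_nonneg (k 2 1)])
  have h21 : k 2 1 = 0 := Complex.normSq_eq_zero.1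
    (by linarith [Complex.normSq_nonneg (k 2 0), Complex.normSq_nonneg (k 2 1)])
  have h02 : k 0 2 = 0 := Complex.normSq_eq_zero.1
    (by linarith [Complex.normSq_nonneg (k 0 2), Complex.normSq_nonneg (k 1 2)])
  have h12 : k 1 2 = 0 := Complex.normSq_eq_zero.1
    (by linarith [Complex.normSq_nonneg (k 0 2), Complex.normSq_nonneg (k 1 2)])
  rw [Matrix.det_fin_three, h22, h20, h21, h02, h12] at hdet
  rw [h20, map_zero, zero_mul, add_zero] at f00 f01
  refine ⟨h20, h21, h02, h12, ?_, ?_, f00⟩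
  · linear_combination k 0 0 * f01 - k 0 1 * f00 - (starRingEnd ℂ) (k 1 0) * hdet
  · linear_combination k 1 0 * f01 - k 1 1 * f00 + (starRingEnd ℂ) (k 0 0) * hdet

/-- LEMMA A (`ZYZ` Euler angles of the `01`-block): every `k ∈ SU(3)` with `k₂₂ = 1` is
`T(a) · (W T(b) W⁻¹) · T(c)` with `b = arccos |k₀₀|`, `a = (arg k₀₀ - arg k₁₀)/2`,
`c = (arg k₀₀ + arg k₁₀)/2`. -/
theorem exists_zyz (T : ℝ → SU3)
    (hT : ∀ θ : ℝ, ((T θ : SU3) : Matrix (Fin 3) (Fin 3) ℂ) =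
      Matrix.diagonal ![Complex.exp (θ * Complex.I), Complex.exp (-(θ * Complex.I)), 1])
    (W : SU3) (hW : (W : Matrix (Fin 3) (Fin 3) ℂ) =
      !![(1 + I) / 2, -((1 + I) / 2), 0; (1 - I) / 2, (1 - I) / 2, 0; 0, 0, 1])
    (k : SU3) (h22 : (k : Matrix (Fin 3) (Fin 3) ℂ) 2 2 = 1) :
    ∃ a b c : ℝ, k = T a * (W * T b * W⁻¹) * T c := by
  obtain ⟨h20, h21, h02, h12, h01, h11, hn⟩ := entries_of_two_two k.2 h22
  obtain ⟨α, hα⟩ : ∃ α : ℂ, (k : Matrix (Fin 3) (Fin 3) ℂ) 0 0 = α := ⟨_, rfl⟩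
  obtain ⟨β, hβ⟩ : ∃ β : ℂ, (k : Matrix (Fin 3) (Fin 3) ℂ) 1 0 = β := ⟨_, rfl⟩
  rw [hα] at hn h11
  rw [hβ] at hn h01
  -- norms and the polar angle `b = arccos ‖α‖`
  have hn' : ‖α‖ ^ 2 + ‖β‖ ^ 2 = 1 := by
    rw [← Complex.normSq_eq_conj_mul_self, ← Complex.normSq_eq_conj_mul_self] at hn
    have h' : Complex.normSq α + Complex.normSq β = 1 := by exact_mod_cast hn
    simpa only [Complex.normSq_eq_norm_sq] using h'
  have hα1 : ‖α‖ ≤ 1 := by nlinarith [norm_nonneg α, norm_nonneg β]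
  have hcos : Real.cos (Real.arccos ‖α‖) = ‖α‖ := Real.cos_arccos (by linarith [norm_nonneg α]) hα1
  have hsin : Real.sin (Real.arccos ‖α‖) = ‖β‖ := by
    rw [Real.sin_arccos, (by linarith : 1 - ‖α‖ ^ 2 = ‖β‖ ^ 2), Real.sqrt_sq (norm_nonneg _)]
  -- polar forms of `α`, `β` and of their conjugates
  have hu : (‖α‖ : ℂ) * cexp (Complex.arg α * I) = α := Complex.norm_mul_exp_arg_mul_I α
  have hv : (‖β‖ : ℂ) * cexp (Complex.arg β * I) = β := Complex.norm_mul_exp_arg_mul_I β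
  have hu' : (starRingEnd ℂ) α = ‖α‖ * cexp (-(Complex.arg α * I)) := by
    conv_lhs => rw [← hu]
    rw [map_mul, Complex.conj_ofReal, ← Complex.exp_conj, map_mul, Complex.conj_ofReal, Complex.conj_I,
      mul_neg]
  have hv' : (starRingEnd ℂ) β = ‖β‖ * cexp (-(Complex.arg β * I)) := by
    conv_lhs => rw [← hv]
    rw [map_mul, Complex.conj_ofReal, ← Complex.exp_conj, map_mul, Complex.conj_ofReal, Complex.conj_I,
      mul_neg]
  -- phase bookkeeping: `a + c = arg α`, `c - a = arg β`
  have e1 : cexp (((Complex.arg α - Complex.arg β) / 2 : ℝ) * I) *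
      cexp (((Complex.arg α + Complex.arg β) / 2 : ℝ) * I) = cexp (Complex.arg α * I) := by
    rw [← Complex.exp_add]; congr 1; push_cast; ring
  have e2 : cexp (((Complex.arg α - Complex.arg β) / 2 : ℝ) * I) *
      cexp (-((((Complex.arg α + Complex.arg β) / 2 : ℝ) : ℂ) * I)) = cexp (-(Complex.arg β * I)) := by
    rw [← Complex.exp_add]; congr 1; push_cast; ring
  have e3 : cexp (-((((Complex.arg α - Complex.arg β) / 2 : ℝ) : ℂ) * I)) *
      cexp (((Complex.arg α + Complex.arg β) / 2 : ℝ) * I) = cexp (Complex.arg β * I) := by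
    rw [← Complex.exp_add]; congr 1; push_cast; ring
  have e4 : cexp (-((((Complex.arg α - Complex.arg β) / 2 : ℝ) : ℂ) * I)) *
      cexp (-((((Complex.arg α + Complex.arg β) / 2 : ℝ) : ℂ) * I)) = cexp (-(Complex.arg α * I)) := by
    rw [← Complex.exp_add]; congr 1; push_cast; ring
  refine ⟨(Complex.arg α - Complex.arg β) / 2, Real.arccos ‖α‖, (Complex.arg α + Complex.arg β) / 2,
    Subtype.ext ?_⟩
  rw [coe_zyz T hT W hW, hcos, hsin, mul_right_comm _ _ (cexp _), e1, mul_right_comm _ _ (cexp _), e2,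
    mul_right_comm _ _ (cexp _), e3, mul_right_comm _ _ (cexp _), e4, mul_comm _ (‖α‖ : ℂ), hu,
    mul_comm _ (‖β‖ : ℂ), ← hv', mul_comm _ (‖β‖ : ℂ), hv, mul_comm _ (‖α‖ : ℂ), ← hu',
    Matrix.eta_fin_three (k : Matrix (Fin 3) (Fin 3) ℂ), h01, h11, h20, h21, h02, h12, h22, hα, hβ]

/-! ### Lemma B: block reduction `g = k₁ · m · k₂⁻¹` with `k₁, k₂` fixing `e₂` and `m` fixing `e₀` -/

/-- A unit vector `(w₁, w₂)` of `ℂ²` annihilated by the row vector `(x, y)`: `x w₁ + y w₂ = 0`. -/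
theorem exists_unit_orth (x y : ℂ) :
    ∃ w₁ w₂ : ℂ, (starRingEnd ℂ) w₁ * w₁ + (starRingEnd ℂ) w₂ * w₂ = 1 ∧ x * w₁ + y * w₂ = 0 := by
  by_cases hx : x = 0
  · exact ⟨1, 0, by simp, by simp [hx]⟩
  · have hr : 0 < Complex.normSq x + Complex.normSq y :=
      add_pos_of_pos_of_nonneg (Complex.normSq_pos.2 hx) (Complex.normSq_nonneg y)
    set ρ : ℝ := Real.sqrt (Complex.normSq x + Complex.normSq y) with hρ_def
    have hρ : 0 < ρ := Real.sqrt_pos.2 hr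
    have hρ2 : (ρ : ℂ) ^ 2 = (starRingEnd ℂ) x * x + (starRingEnd ℂ) y * y := by
      rw [sq, ← Complex.ofReal_mul, Real.mul_self_sqrt hr.le, Complex.ofReal_add,
        Complex.normSq_eq_conj_mul_self, Complex.normSq_eq_conj_mul_self]
    have hρ0 : (ρ : ℂ) ≠ 0 := Complex.ofReal_ne_zero.2 hρ.ne'
    refine ⟨y / ρ, -x / ρ, ?_, ?_⟩
    · rw [map_div₀, map_div₀, map_neg, Complex.conj_ofReal]
      field_simp
      rw [hρ2]
      ring
    · field_simp
      ring

/-- LEMMA B (block reduction): for every `g ∈ SU(3)` there are `k₁, k₂ ∈ SU(3)` with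
`(k₁)₂₂ = (k₂)₂₂ = 1` and `(k₁⁻¹ g k₂)₀₀ = 1`.  (`k₂` has first column a unit vector `(w₁, w₂, 0)`
killed by the third row of `g`; `k₁` has first column the first column of `g k₂`.) -/
theorem block_reduction (g : SU3) :
    ∃ k₁ k₂ : SU3, (k₁ : Matrix (Fin 3) (Fin 3) ℂ) 2 2 = 1 ∧ (k₂ : Matrix (Fin 3) (Fin 3) ℂ) 2 2 = 1 ∧
      ((k₁⁻¹ * (g * k₂) : SU3) : Matrix (Fin 3) (Fin 3) ℂ) 0 0 = 1 := by
  obtain ⟨w₁, w₂, hw, hxw⟩ :=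
    exists_unit_orth ((g : Matrix (Fin 3) (Fin 3) ℂ) 2 0) ((g : Matrix (Fin 3) (Fin 3) ℂ) 2 1)
  set k₂ : SU3 := ⟨_, blockMatrix_mem hw⟩ with hk₂
  -- the first column `v` of `g k₂`
  have hv : ∀ l : Fin 3, ((g * k₂ : SU3) : Matrix (Fin 3) (Fin 3) ℂ) l 0 =
      (g : Matrix (Fin 3) (Fin 3) ℂ) l 0 * w₁ + (g : Matrix (Fin 3) (Fin 3) ℂ) l 1 * w₂ := by
    intro l
    rw [Submonoid.coe_mul, Matrix.mul_apply, Fin.sum_univ_three, hk₂]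
    simp
  have hv2 : ((g * k₂ : SU3) : Matrix (Fin 3) (Fin 3) ℂ) 2 0 = 0 := by rw [hv 2, hxw]
  -- `v` is a unit vector (first column of a unitary matrix)
  have hunit : (starRingEnd ℂ) (((g * k₂ : SU3) : Matrix (Fin 3) (Fin 3) ℂ) 0 0) *
        ((g * k₂ : SU3) : Matrix (Fin 3) (Fin 3) ℂ) 0 0 +
      (starRingEnd ℂ) (((g * k₂ : SU3) : Matrix (Fin 3) (Fin 3) ℂ) 1 0) *
        ((g * k₂ : SU3) : Matrix (Fin 3) (Fin 3) ℂ) 1 0 = 1 := by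
    have hU := Matrix.mem_unitaryGroup_iff'.1 (Matrix.mem_specialUnitaryGroup_iff.1 (g * k₂).2).1
    rw [Matrix.star_eq_conjTranspose] at hU
    have f00 := congr_fun (congr_fun hU 0) 0
    simp only [Matrix.mul_apply, Fin.sum_univ_three, Matrix.conjTranspose_apply, Complex.star_def,
      Matrix.one_apply_eq, hv2, mul_zero, add_zero] at f00
    exact f00
  set k₁ : SU3 := ⟨_, blockMatrix_mem hunit⟩ with hk₁
  refine ⟨k₁, k₂, rfl, rfl, ?_⟩
  rw [Submonoid.coe_mul, ← Matrix.star_eq_inv, Matrix.specialUnitaryGroup.coe_star, hk₁, star_fin_three,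
    Matrix.mul_apply, Fin.sum_univ_three]
  simp only [map_neg, Complex.conj_conj, map_zero, map_one]
  simp [hv2]
  exact hunit

end EulerWord

/-- STUB 3 (E, size M): **surjective word of conjugated circles** (generalized Euler angles for
`SU(3)`).  For the diagonal circle `T(θ) = diag(e^{iθ}, e^{-iθ}, 1)` there are `d = 9` fixed
conjugators `V = (1, W, 1, P, PW, P, 1, W, 1)` (`W` the tilt of the torus into the real rotations of
the `01`-plane, `P` the cyclic permutation) such that every `g ∈ SU(3)` is
`∏ⱼ Vⱼ T(sⱼ) Vⱼ⁻¹ = [Z Y Z]₀₁ · P [Z Y Z]₀₁ P⁻¹ · [Z Y Z]₀₁` for suitable angles `s`. -/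
theorem stub_eulerWord : ∀ T : ℝ → SU3,
    (∀ θ : ℝ, ((T θ : SU3) : Matrix (Fin 3) (Fin 3) ℂ) =
      Matrix.diagonal ![Complex.exp (θ * Complex.I), Complex.exp (-(θ * Complex.I)), 1]) →
    ∃ (d : ℕ) (V : Fin d → SU3), ∀ g : SU3, ∃ s : Fin d → ℝ,
      g = (List.ofFn fun j => V j * T (s j) * (V j)⁻¹).prod := by
  intro T hT
  obtain ⟨W, hW⟩ : ∃ W : SU3, (W : Matrix (Fin 3) (Fin 3) ℂ) =
      !![(1 + Complex.I) / 2, -((1 + Complex.I) / 2), 0; (1 - Complex.I) / 2, (1 - Complex.I) / 2, 0;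
        0, 0, 1] :=
    ⟨⟨_, EulerWord.tiltMatrix_mem⟩, rfl⟩
  obtain ⟨P, hP⟩ : ∃ P : SU3, (P : Matrix (Fin 3) (Fin 3) ℂ) = !![(0 : ℂ), 0, 1; 1, 0, 0; 0, 1, 0] :=
    ⟨⟨_, EulerWord.permMatrix_mem⟩, rfl⟩
  refine ⟨9, ![1, W, 1, P, P * W, P, 1, W, 1], fun g => ?_⟩
  -- block reduction `g = k₁ · m · k₂⁻¹`, `m = k₁⁻¹ g k₂` fixing `e₀`
  obtain ⟨k₁, k₂, hk₁, hk₂, hm⟩ := EulerWord.block_reduction g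
  obtain ⟨a₁, b₁, c₁, h₁⟩ := EulerWord.exists_zyz T hT W hW k₁ hk₁
  have hk₂' : ((k₂⁻¹ : SU3) : Matrix (Fin 3) (Fin 3) ℂ) 2 2 = 1 := by
    rw [← Matrix.star_eq_inv, Matrix.specialUnitaryGroup.coe_star, Matrix.star_apply, hk₂, star_one]
  obtain ⟨a₃, b₃, c₃, h₃⟩ := EulerWord.exists_zyz T hT W hW k₂⁻¹ hk₂'
  -- `P⁻¹ m P` fixes `e₂`
  have hk' : ((P⁻¹ * (k₁⁻¹ * (g * k₂)) * P : SU3) : Matrix (Fin 3) (Fin 3) ℂ) 2 2 = 1 := by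
    rw [Submonoid.coe_mul, Submonoid.coe_mul, ← Matrix.star_eq_inv P, Matrix.specialUnitaryGroup.coe_star,
      hP, EulerWord.perm_conj_apply_two_two, hm]
  obtain ⟨a₂, b₂, c₂, h₂⟩ := EulerWord.exists_zyz T hT W hW _ hk'
  refine ⟨![a₁, b₁, c₁, a₂, b₂, c₂, a₃, b₃, c₃], ?_⟩
  have hg : g = k₁ * (P * (P⁻¹ * (k₁⁻¹ * (g * k₂)) * P) * P⁻¹) * k₂⁻¹ := by group
  rw [h₂] at hg
  rw [h₁, h₃] at hg
  rw [hg]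
  simp only [List.ofFn_succ, List.ofFn_zero, List.prod_cons, List.prod_nil, Matrix.cons_val_zero,
    Matrix.cons_val_succ]
  group

end Summit.QuantumFields.QCD.Theorems.CircleTransport
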